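import Mathlib
import HarnessLib
import Literature.NumberTheory.Transcendental.KZCalculus
import Literature.NumberTheory.Transcendental.KZLogCalculusProofs
import Literature.NumberTheory.Transcendental.MZVSimplexRepProofs
import Summits.KontsevichZagierPeriods.KontsevichZagierPeriods.Theorems.MzvKernelInKZ.Negative.Core
import Summits.KontsevichZagierPeriods.KontsevichZagierPeriods.Theorems.LinRedNormalFormDihedralNormalFormStubCellZetaMovesLowAux1

/-!
# Stub `stub_cellZetaMovesLow` of line `tame-bv-stokes` (crux `DihedralNormalForm`)

Registered stub `stub_cellZetaMovesLow` of the reduction skeleton of the crux `DihedralNormalForm`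
(line `tame-bv-stokes`): the **low-dimensional cells `ℓ ≤ 2`** of the cellular zeta reduction.
`LogRep ℓ` is the set of integral representations on the open ordered simplex
`Δ_ℓ = {1 > t₀ > ⋯ > t_{ℓ-1} > 0}` whose integrand agrees there with a `ℚ`-combination
`Σ_f q_f ∏ᵢ 1/(tᵢ - a_{f,i})` of Arnold products, the letter `a_{f,i}` being decoded from
`f i : Fin (ℓ+2)` (value `0 ↦ 0`, `1 ↦ 1`, `v ≥ 2 ↦ t_{v-2}` if `v - 2 < i`, else the junk letter
`0`). The claim: every element of `LogRep ℓ`, `ℓ ≤ 2`, lies in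
`KZ.relations ⊔ ⟨MZV word representations⟩`. In these dimensions no move is needed — absolute
convergence forces the combination to BE a word representation (or zero):

* `ℓ = 0`: the integrand is the rational constant `Σ_f q_f` on the point `ℝ⁰`: the empty word.
* `ℓ = 1`: the integrand is `c₀/t + c₁/(t-1)` on `(0,1)`; integrability at `0` and at `1` forces
  `c₀ = c₁ = 0` (`cellZeta_one_coeffs`), so the representation is a zero representation, a relation.
* `ℓ = 2`: regrouping the sixteen products gives the six-term Arnold combination of
  `cellZeta_six` (tools file `…StubCellZetaMovesLowAux1`), whose residues along `t₁ → 0`,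
  `t₁ → t₀`, `t₀ → 1` force all coefficients but that of `1/(t₀(t₁-1))` to vanish: the integrand
  is `(-c₀₁) · (1/t₀) · (1/(1-t₁))`, the `ζ(2)` word `01`.

References: M. Kontsevich, D. Zagier, *Periods* (2001), §1.1; F. Brown, S. Carr, L. Schneps,
*The algebra of cell-zeta values*, Compositio Math. 146 (2010), §4.4.
-/

noncomputable section

open MeasureTheory Set
open Literature.NumberTheory.Transcendental
open Summit.KontsevichZagierPeriods.MzvKernelInKZ.Negative

namespace Summit.KontsevichZagierPeriods.DihedralNormalForm.TameBVStokes

/-! ### Dimension two -/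

/-- **Regrouping in dimension two.** Off the five hyperplanes `t₀, t₁ ∈ {0,1}`, `t₀ = t₁`, the
sixteen decoded Arnold products regroup into the six-term combination with coefficients the fibre
sums of `q`. [folklore] -/
theorem cellZeta_integrand_two (q : (Fin 2 → Fin 4) → ℚ) (t : Fin 2 → ℝ) (ht0 : t 0 ≠ 0)
    (ht1 : t 1 ≠ 0) (h01 : t 0 - 1 ≠ 0) (h11 : t 1 - 1 ≠ 0) (h : t 1 - t 0 ≠ 0) :
    (∑ f : Fin 2 → Fin 4, (q f : ℝ) * ∏ i : Fin 2, 1 / (t i -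
      (if ((f i : Fin 4) : ℕ) = 0 then (0:ℝ) else if ((f i : Fin 4) : ℕ) = 1 then 1
        else if h : ((f i : Fin 4) : ℕ) - 2 < (i : ℕ) then
          t ⟨((f i : Fin 4) : ℕ) - 2, lt_trans h i.isLt⟩ else 0))) =
    ((q ![0, 0] + q ![0, 3] + q ![2, 0] + q ![2, 3] + q ![3, 0] + q ![3, 3] : ℚ) : ℝ) / (t 0 * t 1) +
    ((q ![1, 0] + q ![1, 3] : ℚ) : ℝ) / ((t 0 - 1) * t 1) +
    ((q ![0, 1] + q ![2, 1] + q ![3, 1] : ℚ) : ℝ) / (t 0 * (t 1 - 1)) +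
    ((q ![1, 1] : ℚ) : ℝ) / ((t 0 - 1) * (t 1 - 1)) +
    ((q ![0, 2] + q ![2, 2] + q ![3, 2] : ℚ) : ℝ) / (t 0 * (t 1 - t 0)) +
    ((q ![1, 2] : ℚ) : ℝ) / ((t 0 - 1) * (t 1 - t 0)) := by
  simp only [Fin.prod_univ_two, Fin.val_zero, Fin.val_one]
  rw [← Equiv.sum_comp (finTwoArrowEquiv (Fin 4)).symm]
  simp only [finTwoArrowEquiv_symm_apply, Fintype.sum_prod_type, Fin.sum_univ_four,
    Matrix.cons_val_zero, Matrix.cons_val_one]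
  norm_num
  field_simp
  ring

/-- On the open 2-simplex the five denominators `t₀, t₁, t₀-1, t₁-1, t₁-t₀` do not vanish.
[folklore] -/
theorem cellZeta_denom_two {t : Fin 2 → ℝ}
    (ht : t ∈ {t : Fin 2 → ℝ | (∀ i, 0 < t i) ∧ (∀ i, t i < 1) ∧ StrictAnti t}) :
    t 0 ≠ 0 ∧ t 1 ≠ 0 ∧ t 0 - 1 ≠ 0 ∧ t 1 - 1 ≠ 0 ∧ t 1 - t 0 ≠ 0 := by
  obtain ⟨h0, h1, h2⟩ := ht
  have h10 : t 1 < t 0 := h2 (show (0 : Fin 2) < 1 by decide)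
  exact ⟨(h0 0).ne', (h0 1).ne', sub_ne_zero.2 (h1 0).ne, sub_ne_zero.2 (h1 1).ne,
    sub_ne_zero.2 h10.ne⟩

/-- **The cell `ℓ = 2`.** A representation on the open 2-simplex whose integrand is a convergent
`ℚ`-combination of decoded Arnold products is an MZV word representation (the `ζ(2)` word `01`
with coefficient `-c₀₁`), hence lies in `relations ⊔ ⟨word representations⟩`.
[cite: KontsevichZagier2001, §1.1] -/
theorem cellZeta_case_two (q : (Fin 2 → Fin 4) → ℚ) (s : KZ.IntegralRep 2)
    (hdom : s.domain = {t : Fin 2 → ℝ | (∀ i, 0 < t i) ∧ (∀ i, t i < 1) ∧ StrictAnti t})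
    (hint : EqOn s.integrand (fun t => ∑ f : Fin 2 → Fin 4, (q f : ℝ) * ∏ i : Fin 2, 1 / (t i -
      (if ((f i : Fin 4) : ℕ) = 0 then (0:ℝ) else if ((f i : Fin 4) : ℕ) = 1 then 1
        else if h : ((f i : Fin 4) : ℕ) - 2 < (i : ℕ) then
          t ⟨((f i : Fin 4) : ℕ) - 2, lt_trans h i.isLt⟩ else 0))) s.domain) :
    KZ.of s ∈ KZ.relations ⊔ AddSubgroup.closure genSet := by
  -- integrability of the six-term combination on the simplex
  have hF : IntegrableOn (fun t : Fin 2 → ℝ =>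
      ((q ![0, 0] + q ![0, 3] + q ![2, 0] + q ![2, 3] + q ![3, 0] + q ![3, 3] : ℚ) : ℝ) / (t 0 * t 1) +
      ((q ![1, 0] + q ![1, 3] : ℚ) : ℝ) / ((t 0 - 1) * t 1) +
      ((q ![0, 1] + q ![2, 1] + q ![3, 1] : ℚ) : ℝ) / (t 0 * (t 1 - 1)) +
      ((q ![1, 1] : ℚ) : ℝ) / ((t 0 - 1) * (t 1 - 1)) +
      ((q ![0, 2] + q ![2, 2] + q ![3, 2] : ℚ) : ℝ) / (t 0 * (t 1 - t 0)) +
      ((q ![1, 2] : ℚ) : ℝ) / ((t 0 - 1) * (t 1 - t 0)))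
      {t : Fin 2 → ℝ | (∀ i, 0 < t i) ∧ (∀ i, t i < 1) ∧ StrictAnti t} := by
    have h := s.integrableOn
    rw [hdom] at h
    refine h.congr_fun (fun t ht => ?_) (KZ.measurableSet_openOrderedSimplex 2)
    have ht' : t ∈ s.domain := by rw [hdom]; exact ht
    obtain ⟨a, b, c, d, e⟩ := cellZeta_denom_two ht
    exact (hint ht').trans (cellZeta_integrand_two q t a b c d e)
  obtain ⟨e00, e10, e11, e0t, e1t⟩ := cellZeta_six _ _ _ _ _ _ hF
  refine AddSubgroup.mem_sup_right (AddSubgroup.subset_closure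
    ⟨2, ![false, true], -(q ![0, 1] + q ![2, 1] + q ![3, 1]), s, hdom, fun t ht => ?_, rfl⟩)
  have ht' : t ∈ {t : Fin 2 → ℝ | (∀ i, 0 < t i) ∧ (∀ i, t i < 1) ∧ StrictAnti t} := by
    rw [← hdom]; exact ht
  obtain ⟨a, b, c, d, e⟩ := cellZeta_denom_two ht'
  rw [hint ht]
  dsimp only
  rw [cellZeta_integrand_two q t a b c d e, e00, e10, e11, e0t, e1t]
  have h1 : (1 : ℝ) - t 1 ≠ 0 := fun h => d (by linarith)
  simp only [Fin.prod_univ_two, Matrix.cons_val_zero, Matrix.cons_val_one, Bool.false_eq_true,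
    if_false, if_true, zero_div, zero_add, add_zero]
  push_cast
  field_simp
  ring

/-! ### Dimension one -/

/-- **Regrouping in dimension one.** Off `t ∈ {0, 1}` the three decoded products regroup into
`c₀/t + c₁/(t-1)` (the values `0` and `2` both decode to the letter `0`). [folklore] -/
theorem cellZeta_integrand_one (q : (Fin 1 → Fin 3) → ℚ) (t : Fin 1 → ℝ) (ht0 : t 0 ≠ 0)
    (h01 : t 0 - 1 ≠ 0) :
    (∑ f : Fin 1 → Fin 3, (q f : ℝ) * ∏ i : Fin 1, 1 / (t i -
      (if ((f i : Fin 3) : ℕ) = 0 then (0:ℝ) else if ((f i : Fin 3) : ℕ) = 1 then 1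
        else if h : ((f i : Fin 3) : ℕ) - 2 < (i : ℕ) then
          t ⟨((f i : Fin 3) : ℕ) - 2, lt_trans h i.isLt⟩ else 0))) =
    ((q (fun _ => 0) + q (fun _ => 2) : ℚ) : ℝ) / t 0 + ((q (fun _ => 1) : ℚ) : ℝ) / (t 0 - 1) := by
  have hu : ∀ v : Fin 3, (uniqueElim (α := fun _ : Fin 1 => Fin 3) v) = fun _ => v :=
    fun v => funext fun i => uniqueElim_const v i
  simp only [Fin.prod_univ_one, Fin.val_zero]
  rw [← Equiv.sum_comp (Equiv.funUnique (Fin 1) (Fin 3)).symm]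
  simp only [Fin.sum_univ_three, Equiv.funUnique_symm_apply, hu]
  norm_num
  field_simp
  ring

/-- **Residues in dimension one.** If `c₀/t + c₁/(t-1)` is integrable on the open 1-simplex
`(0, 1)`, then `c₀ = c₁ = 0`. [cite: KontsevichZagier2001, §1.1] -/
theorem cellZeta_one_coeffs (c₀ c₁ : ℝ)
    (h : IntegrableOn (fun t : Fin 1 → ℝ => c₀ / t 0 + c₁ / (t 0 - 1))
      {t : Fin 1 → ℝ | (∀ i, 0 < t i) ∧ (∀ i, t i < 1) ∧ StrictAnti t}) : c₀ = 0 ∧ c₁ = 0 := by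
  set e := MeasurableEquiv.funUnique (Fin 1) ℝ with he
  have hmp : MeasurePreserving e.symm volume volume := (volume_preserving_funUnique (Fin 1) ℝ).symm e
  have h1 := (hmp.integrableOn_comp_preimage e.symm.measurableEmbedding).2 h
  have hT : e.symm ⁻¹' {t : Fin 1 → ℝ | (∀ i, 0 < t i) ∧ (∀ i, t i < 1) ∧ StrictAnti t} =
      Ioo 0 1 := by
    ext x
    simp only [mem_preimage, mem_setOf_eq, Fin.forall_fin_one, mem_Ioo]
    exact ⟨fun hx => ⟨hx.1, hx.2.1⟩, fun hx => ⟨hx.1, hx.2, Subsingleton.strictAnti _⟩⟩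
  rw [hT] at h1
  have h2 : IntegrableOn (fun x : ℝ => c₀ / x + c₁ / (x - 1)) (Ioo 0 1) :=
    h1.congr_fun (fun x _ => rfl) measurableSet_Ioo
  constructor
  · have hB : ContinuousOn (fun x : ℝ => c₁ / (x - 1)) (Icc 0 (1 / 2)) :=
      continuousOn_const.div (by fun_prop) fun x hx => by
        intro h; linarith [hx.2, sub_eq_zero.1 h]
    refine cellZeta_residue_left (by norm_num : (0:ℝ) < 1 / 2)
      ((hB.integrableOn_compact isCompact_Icc).mono_set Ioo_subset_Icc_self)
      (h2.mono_set (Ioo_subset_Ioo_right (by norm_num))) fun x _ => ?_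
    simp only [sub_zero, div_eq_mul_inv]
  · have hB : ContinuousOn (fun x : ℝ => c₀ / x) (Icc (1 / 2) 1) :=
      continuousOn_const.div (by fun_prop) fun x hx => by
        intro h; linarith [hx.1]
    refine cellZeta_residue_right (by norm_num : (1:ℝ) / 2 < 1)
      ((hB.integrableOn_compact isCompact_Icc).mono_set Ioo_subset_Icc_self)
      (h2.mono_set (Ioo_subset_Ioo_left (by norm_num))) fun x _ => ?_
    simp only [div_eq_mul_inv]
    ring

/-- **The cell `ℓ = 1`.** A representation on `(0, 1)` whose integrand is a convergent
`ℚ`-combination of decoded Arnold products has zero integrand on its domain, hence is a relation.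
[cite: KontsevichZagier2001, §1.1] -/
theorem cellZeta_case_one (q : (Fin 1 → Fin 3) → ℚ) (s : KZ.IntegralRep 1)
    (hdom : s.domain = {t : Fin 1 → ℝ | (∀ i, 0 < t i) ∧ (∀ i, t i < 1) ∧ StrictAnti t})
    (hint : EqOn s.integrand (fun t => ∑ f : Fin 1 → Fin 3, (q f : ℝ) * ∏ i : Fin 1, 1 / (t i -
      (if ((f i : Fin 3) : ℕ) = 0 then (0:ℝ) else if ((f i : Fin 3) : ℕ) = 1 then 1
        else if h : ((f i : Fin 3) : ℕ) - 2 < (i : ℕ) then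
          t ⟨((f i : Fin 3) : ℕ) - 2, lt_trans h i.isLt⟩ else 0))) s.domain) :
    KZ.of s ∈ KZ.relations ⊔ AddSubgroup.closure genSet := by
  have hS : ∀ t ∈ s.domain, t 0 ≠ 0 ∧ t 0 - 1 ≠ 0 := by
    intro t ht
    rw [hdom] at ht
    exact ⟨(ht.1 0).ne', sub_ne_zero.2 (ht.2.1 0).ne⟩
  have hF : IntegrableOn (fun t : Fin 1 → ℝ =>
      ((q (fun _ => 0) + q (fun _ => 2) : ℚ) : ℝ) / t 0 + ((q (fun _ => 1) : ℚ) : ℝ) / (t 0 - 1))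
      {t : Fin 1 → ℝ | (∀ i, 0 < t i) ∧ (∀ i, t i < 1) ∧ StrictAnti t} := by
    have h := s.integrableOn
    rw [hdom] at h
    refine h.congr_fun (fun t ht => ?_) (KZ.measurableSet_openOrderedSimplex 1)
    have ht' : t ∈ s.domain := by rw [hdom]; exact ht
    obtain ⟨a, b⟩ := hS t ht'
    exact (hint ht').trans (cellZeta_integrand_one q t a b)
  obtain ⟨e0, e1⟩ := cellZeta_one_coeffs _ _ hF
  refine AddSubgroup.mem_sup_left (KZ.of_mem_relations_of_eqOn_zero s fun t ht => ?_)
  obtain ⟨a, b⟩ := hS t ht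
  rw [hint ht]
  dsimp only
  rw [cellZeta_integrand_one q t a b, e0, e1]
  simp

/-! ### Dimension zero -/

/-- **The cell `ℓ = 0`.** A zero-dimensional representation with integrand the rational constant
`Σ_f q_f` is the empty-word representation `[pt, Σ_f q_f]`. [folklore] -/
theorem cellZeta_case_zero (q : (Fin 0 → Fin 2) → ℚ) (s : KZ.IntegralRep 0)
    (hdom : s.domain = {t : Fin 0 → ℝ | (∀ i, 0 < t i) ∧ (∀ i, t i < 1) ∧ StrictAnti t})
    (hint : EqOn s.integrand (fun t => ∑ f : Fin 0 → Fin 2, (q f : ℝ) * ∏ i : Fin 0, 1 / (t i -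
      (if ((f i : Fin 2) : ℕ) = 0 then (0:ℝ) else if ((f i : Fin 2) : ℕ) = 1 then 1
        else if h : ((f i : Fin 2) : ℕ) - 2 < (i : ℕ) then
          t ⟨((f i : Fin 2) : ℕ) - 2, lt_trans h i.isLt⟩ else 0))) s.domain) :
    KZ.of s ∈ KZ.relations ⊔ AddSubgroup.closure genSet := by
  refine AddSubgroup.mem_sup_right (AddSubgroup.subset_closure
    ⟨0, Fin.elim0, ∑ f : Fin 0 → Fin 2, q f, s, hdom, fun t ht => ?_, rfl⟩)
  rw [hint ht]
  simp

/-! ### The registered stub -/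

/-- **Stub `stub_cellZetaMovesLow`** (line `tame-bv-stokes`, crux `DihedralNormalForm`): for
`ℓ ≤ 2` every representation on the open ordered simplex `Δ_ℓ` whose integrand is a convergent
`ℚ`-combination of decoded Arnold products lies in `KZ.relations ⊔ ⟨MZV word representations⟩` —
the empty word (`ℓ = 0`), a zero representation (`ℓ = 1`), or the `ζ(2)` word (`ℓ = 2`).
[cite: KontsevichZagier2001, §1.1] -/
theorem stub_cellZetaMovesLow (LogRep : ℕ → Set Literature.NumberTheory.Transcendental.KZ.FormalRep) (hLogRep : ∀ ℓ, LogRep ℓ = {y : Literature.NumberTheory.Transcendental.KZ.FormalRep | ∃ (q : (Fin ℓ → Fin (ℓ + 2)) → ℚ) (s : Literature.NumberTheory.Transcendental.KZ.IntegralRep ℓ), s.domain = {t : Fin ℓ → ℝ | (∀ i, 0 < t i) ∧ (∀ i, t i < 1) ∧ StrictAnti t} ∧ Set.EqOn s.integrand (fun t => ∑ f : Fin ℓ → Fin (ℓ + 2), (q f : ℝ) * ∏ i : Fin ℓ, 1 / (t i - (if ((f i : Fin (ℓ + 2)) : ℕ) = 0 then (0:ℝ) else if ((f i : Fin (ℓ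 + 2)) : ℕ) = 1 then 1 else if h : ((f i : Fin (ℓ + 2)) : ℕ) - 2 < (i : ℕ) then t ⟨((f i : Fin (ℓ + 2)) : ℕ) - 2, lt_trans h i.isLt⟩ else 0))) s.domain ∧ y = Literature.NumberTheory.Transcendental.KZ.of s}) : ∀ (ℓ : ℕ), ℓ ≤ 2 → ∀ y ∈ LogRep ℓ, y ∈ Literature.NumberTheory.Transcendental.KZ.relations ⊔ AddSubgroup.closure {x : Literature.NumberTheory.Transcendental.KZ.FormalRep | ∃ (w : ℕ) (ε : Fin w → Bool) (q : ℚ) (s : Literature.NumberTheory.Transcendental.KZ.IntegralRep w), s.domain = {t : Fin w → ℝ | (∀ i, 0 < t i) ∧ (∀ i, t i < 1) ∧ StrictAnti t} ∧ Set.EqOn s.integrand (fun t => (q : ℝ) * ∏ i, if ε i then 1 / (1 - t i) else 1 / t i) s.domain ∧ x = Literature.NumberTheory.Transcendental.KZ.of s} := by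
  intro ℓ hℓ y hy
  rw [hLogRep] at hy
  obtain ⟨q, s, hdom, hint, rfl⟩ := hy
  interval_cases ℓ
  · exact cellZeta_case_zero q s hdom hint
  · exact cellZeta_case_one q s hdom hint
  · exact cellZeta_case_two q s hdom hint

end Summit.KontsevichZagierPeriods.DihedralNormalForm.TameBVStokes
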